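import Literature.AlgebraicGeometry.Morphisms.CechModuleExact
import HarnessLib

/-!
# Exactness of the low-degree Čech sequence at `Ȟ⁰(𝒰, M'')`

`Literature/AlgebraicGeometry/Morphisms/CechModuleExact.lean` constructs, for a scheme
`f : X → Spec A`, a family of opens `𝒰` and morphisms of `𝒪_X`-modules `φ : M' → M`, `ψ : M → M''`
carrying sectionwise exactness data (`CechExactData`: `ψ ∘ φ = 0`, `φ` injective with
`im φ = ker ψ` on sections, `ψ` surjective on the `U_i`), the connecting homomorphism
`δ : Ȟ⁰(𝒰, M'') → Ȟ¹(𝒰, M')` and proves the exactness of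
`0 → Ȟ⁰(M') → Ȟ⁰(M) → Ȟ⁰(M'') —δ→ Ȟ¹(M') → Ȟ¹(M) → Ȟ¹(M'')` everywhere EXCEPT at `Ȟ⁰(M'')`
("deliberately not treated" there). This file adds that missing exactness (Hartshorne,
*Algebraic Geometry*, III, proof of Thm. 4.5: the long exact sequence of a short exact sequence of
Čech complexes; standard diagram chase):

* `CechExactData.cechDelta_cechMapH0` — `δ ∘ Ȟ⁰(ψ) = 0` (compute `δ` with the lift `b` itself, whose
  coboundary is `0 = φ 0`);
* `CechExactData.exists_cechMapH0_eq_of_cechDelta_eq_zero` — **`ker δ ⊆ im Ȟ⁰(ψ)`**: if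
  `δ b'' = [c'] = 0` then `c' = d⁰ e'`, and the corrected lift `b - φ e'` is a `0`-cocycle of `M`
  mapping to `b''`.

This is the criterion "a section of `M''` over `X` lifts to `M` iff its obstruction class in
`Ȟ¹(𝒰, M')` vanishes", the form in which the connecting homomorphism enters the proof of the
theorem on formal functions (The Stacks Project, Tag 02OB/02OC, sequences
`0 → I^n𝒪_X → 𝒪_X → 𝒪_{X_n} → 0`; cf. `Literature/AlgebraicGeometry/Morphisms/FormalFunctionsMittagLeffler.lean`
and the principal-ideal case `LiftData.exists_restrict_eq` of `Morphisms/CechH1`). Everything is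
proved; no named facts.

## References

* R. Hartshorne, *Algebraic Geometry*, GTM 52, Springer (1977): III, proof of Thm. 4.5 (p. 222).
  [Hartshorne1977]
* The Stacks Project, Tag 02OB (Cohomology of Schemes, Lemma 30.20.4, use of the long exact
  cohomology sequence). [StacksProject]
-/

noncomputable section

open CategoryTheory AlgebraicGeometry

universe u v

namespace Literature.AlgebraicGeometry.Morphisms

variable {A : Type u} [CommRing A] {X : Scheme.{u}} {f : X ⟶ Spec (.of A)}
variable {ι : Type v} {U : ι → X.Opens} {M' M M'' : X.Modules} {φ : M' ⟶ M} {ψ : M ⟶ M''}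

namespace CechExactData

variable (h : CechExactData f U φ ψ)
include h

/-- **`δ ∘ Ȟ⁰(ψ) = 0`**: the connecting homomorphism kills the classes coming from `Ȟ⁰(𝒰, M)`
(compute `δ (ψ b)` with the lift `b`, a cocycle, so the attached cochain is `0`).
[cite: Hartshorne1977, III Thm. 4.5 proof p. 222 (long exact sequence of Čech cohomology)] -/
theorem cechDelta_cechMapH0 (b : cechMH0 f M U) : h.cechDelta (cechMapH0 f ψ U b) = 0 := by
  rw [h.cechDelta_spec (cechMapH0 f ψ U b) b (by rw [cechMapH0_coe]) 0
    (by rw [map_zero]; exact ((LinearMap.mem_ker).mp b.2).symm)]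
  exact map_zero _

/-- **Exactness at `Ȟ⁰(𝒰, M'')`: `ker δ ⊆ im Ȟ⁰(ψ)`.** If `δ b'' = 0`, i.e. the cocycle `c'` with
`φ c' = d⁰ b` for the chosen lift `b` of `b''` is a coboundary `d⁰ e'`, then `b - φ e'` is a
`0`-cocycle of `M` on `𝒰` (its coboundary is `φ c' - φ d⁰ e' = 0`) with `ψ (b - φ e') = b''`.
[cite: Hartshorne1977, III Thm. 4.5 proof p. 222 (long exact sequence of Čech cohomology)] -/
theorem exists_cechMapH0_eq_of_cechDelta_eq_zero (b'' : cechMH0 f M'' U)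
    (hb : h.cechDelta b'' = 0) : ∃ b : cechMH0 f M U, cechMapH0 f ψ U b = b'' := by
  change CechMH1.mk f M' U _ = 0 at hb
  rw [CechMH1.mk_eq_zero_iff, mem_cechMB1_iff] at hb
  obtain ⟨e', he'⟩ := hb
  -- the corrected lift `lift b'' - φ e'` is a cocycle mapping to `b''`
  refine ⟨⟨h.lift b'' - cechMapC0 f φ U e', ?_⟩, ?_⟩
  · rw [cechMH0, LinearMap.mem_ker, map_sub, cechMD0_mapC0, he', h.app_deltaCocycle, sub_self]
  · apply Subtype.ext
    rw [cechMapH0_coe]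
    change cechMapC0 f ψ U (h.lift b'' - cechMapC0 f φ U e') = b''
    rw [map_sub, h.app_lift, sub_eq_self]
    funext i
    rw [cechMapC0_apply, cechMapC0_apply, h.app_app]
    rfl

end CechExactData

end Literature.AlgebraicGeometry.Morphisms

end
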